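import Summits.ABC.ABC.Theses.IsogenyGlueCongruence
import Literature.NumberTheory.EllipticCurves.PastenSpectralDegreeIsogenyBoundProofs
import Literature.NumberTheory.EllipticCurves.PastenSpectralDegreeProductFormProofs
import Literature.NumberTheory.EllipticCurves.RationalIsogenyDegrees
import Literature.NumberTheory.EllipticCurves.ModularCurveManinSemistableCoprimeFormProofs
import Literature.NumberTheory.EllipticCurves.EichlerShimuraConstructionProofs
import Literature.NumberTheory.EllipticCurves.GlobalMinimalModelProofs
import Literature.NumberTheory.EllipticCurves.ModularCurveNeronLatticeProofs
import Literature.NumberTheory.DiophantineGeometry.FaltingsHeightIsogenyFiniteProofs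
import Mathlib.NumberTheory.Padics.PadicNumbers
import HarnessLib

/-!
# Crux A `DegreePrimesPolyBounded` (stmt-ABC-2045), line `newpart_congruence_friability` —
# stub `stub_mazurKenku`, RESHAPED to Mazur–Kenku + Edixhoven (optimal curve only), semistable slice

The registered stub `stub_mazurKenku : PastenShimura2024_minimalDegree_le_163_mul` (Pasten 2024,
§3 p. 13; Mazur 1978 Thm. 1 + Kenku 1982) is, over the tree, equivalent to its Néron-lattice form
`hMK` (`PastenShimura2024_minimalDegree_le_163_mul_iff`) and reduced by
`PastenShimura2024_minimalDegree_le_163_mul_of_mazurKenku` to the named fact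
`mazurKenku_exists_cyclic_isogeny` plus `hInt` — *every rational multiplier `q Λ_f ⊆ Λ_{E'}` into
the Néron lattice of ANY parametrised global minimal model is an integer* (the Manin constant of an
arbitrary parametrisation; Stevens 1989 §1 — no statement in the tree). Here `hInt` is split and
its isogeny half PROVED for semistable targets, with no Néron models: if `q ∈ ℚ` and
`q Λ_{W₀} ⊆ Λ_W` for the Néron lattices of a global minimal `W₀` and a SEMISTABLE global minimal
`W`, then `q ∈ ℤ` (`exists_intCast_eq_of_forall_mul_mem_lattice_of_isSemistable`: the tree's
sublattice dichotomy `PeriodPair.valuationSubring_dichotomy_of_le`, Lang *Elliptic Functions*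
Ch. 12 §2, at a valuation ring of `ℂ` above a prime of the denominator of `q`, against
`gcd(c₄, Δ_min) = 1`). Hence the SEMISTABLE slice of `hInt` follows from Edixhoven 1991, Prop. 2
for the OPTIMAL curve alone (`hEd`: the global minimal model of `A_{1,N} = ℂ/Λ_f` has Néron lattice
`c_f Λ_f`, `c_f ∈ ℤ`; stated structurally, verbatim the hypothesis `hEd` of the tree's
`Literature.NumberTheory.Automorphic.exists_optimal_modularParametrizationData_of_edixhoven`, where
it is identified as the content of the named fact `exists_optimal_modularParametrizationData` beyond
modularity), and the REGISTERED reshaped stub `stub_mazurKenkuSemistable_of_mazurIsogeny_of_edixhoven`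
is `mazurKenku_exists_cyclic_isogeny → hEd →` the PRODUCT form
(`PastenShimura2024_exists_datum_modularDegree_eq_mul_of`) for SEMISTABLE `W` — the only form in
which the frame's glue `degreePrimesPolyBounded_of_newPartPrimesOfDatum` consumes the stub, and implied
by the stub (`PastenShimura2024_exists_datum_modularDegree_eq_mul_of`). Trust base of the reshape:
Mazur–Kenku and Edixhoven's Prop. 2 for `A_{1,N}`. No definition, no named fact, nothing restated.

References: [PastenShimura2024] §2 p. 12, §3 p. 13; [Mazur1978] Thm. 1; [Kenku1982];
[SilvermanAEC2009] VII.5.1, VIII.8.3, IX.6 Ex. 6.4; [EdixhovenManin1991] Prop. 2; [AgasheRibetStein2006]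
Thm. 2.2; [Lang1987] Ch. 12 §2 Thm. 2–4; [Faltings1986FinitenessTranslation] §3 Lemma 5.
-/

-- `Summit.ABC.ABC` is the mandated summit-side namespace (CONVENTIONS §2); the duplicate is deliberate.
set_option linter.dupNamespace false
noncomputable section
open scoped MatrixGroups ModularForm
open CongruenceSubgroup
open Literature.NumberTheory.EllipticCurves
open Literature.NumberTheory.EllipticCurves.ModularForms
open Summit.ABC.ABC.Theses.IsogenyGlueCongruence
namespace Summit.ABC.ABC.Theorems.DegreePrimesPolyBounded

/-- **A valuation subring of `ℂ` above `p`** (Chevalley, `IsLocalRing.exists_factor_valuationRing` for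
`ℤ_(p) → ℂ`): `y ∈ A ⟺ 0 ≤ ord_p(y)` for rational `y` (for `ord_p y < 0`, `y⁻¹` is a non-unit of
`ℤ_(p)`, hence of `A`); the case `K = ℚ` of the tree's `exists_valuationSubring_map_mem_iff`. [folklore] -/
theorem exists_valuationSubring_ratCast_mem_iff (p : ℕ) [Fact p.Prime] :
    ∃ A : ValuationSubring ℂ, ∀ y : ℚ, (y : ℂ) ∈ A ↔ 0 ≤ padicValRat p y := by
  set Rv : ValuationSubring ℚ := (Rat.padicValuation p).valuationSubring with hRv
  have hmem : ∀ y : ℚ, y ∈ Rv ↔ Rat.padicValuation p y ≤ 1 := fun y ↦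
    Valuation.mem_valuationSubring_iff _ _
  have hiff : ∀ y : ℚ, Rat.padicValuation p y ≤ 1 ↔ 0 ≤ padicValRat p y := fun y ↦ by
    by_cases hy : y = 0
    · subst hy
      simp
    · simp only [Rat.padicValuation, Valuation.coe_mk, MonoidWithZeroHom.coe_mk, ZeroHom.coe_mk,
        if_neg hy]
      rw [← WithZero.exp_zero, WithZero.exp_le_exp, neg_nonpos]
  set f : Rv →+* ℂ := (Rat.castHom ℂ).comp Rv.subtype with hf
  obtain ⟨A, hA, hloc⟩ := IsLocalRing.exists_factor_valuationRing f
  refine ⟨A, fun y ↦ Iff.trans ⟨fun hy ↦ ?_, fun hy ↦ hA ⟨y, (hmem y).mpr hy⟩⟩ (hiff y)⟩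
  by_contra hv
  have hy' : y ∉ Rv := fun h ↦ hv ((hmem y).mp h)
  obtain ⟨hy0, hz, hzn⟩ := PeriodPair.inv_mem_nonunits_of_not_mem hy'
  have h1 : ¬ IsUnit (f.codRestrict A.toSubring hA ⟨y⁻¹, hz⟩) :=
    fun hu ↦ hzn (hloc.map_nonunit _ hu)
  apply h1
  refine IsUnit.of_mul_eq_one ⟨(y : ℂ), hy⟩ (Subtype.ext ?_)
  change ((y⁻¹ : ℚ) : ℂ) * (y : ℂ) = 1
  rw [← Rat.cast_mul, inv_mul_cancel₀ hy0, Rat.cast_one]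

/-- `1 ≤ ord_p(n)` forces `p ∣ n`, for an integer `n`. [folklore] -/
theorem intCast_dvd_of_one_le_padicValRat {p : ℕ} [Fact p.Prime] {n : ℤ}
    (h : 1 ≤ padicValRat p (n : ℚ)) : (p : ℤ) ∣ n := by
  rw [padicValRat.of_int] at h
  have h1 : (1 : ℕ) ≤ padicValInt p n := by exact_mod_cast h
  simpa only [pow_one] using (padicValInt_dvd_iff 1 n).mpr (Or.inr h1)

/-- `0 ≤ ord_p(n)` for an integer `n`. [folklore] -/
theorem padicValRat_intCast_nonneg (p : ℕ) (n : ℤ) : 0 ≤ padicValRat p (n : ℚ) := by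
  rw [padicValRat.of_int]
  exact_mod_cast Nat.zero_le _

/-- `j(Λ) = m³/d` when `12 g₂(Λ) = m` and `g₂(Λ)³ − 27 g₃(Λ)² = d` (`1728 g₂³ = (12 g₂)³`). [folklore] -/
theorem j_eq_ratCast_of_intCast {L : PeriodPair} {m d : ℤ} (hm : 12 * L.g₂ = m)
    (hd : L.g₂ ^ 3 - 27 * L.g₃ ^ 2 = d) : L.j = (((m : ℚ) ^ 3 / d : ℚ) : ℂ) := by
  rw [PeriodPair.j_def, hd, show (1728 : ℂ) * L.g₂ ^ 3 = (12 * L.g₂) ^ 3 by ring, hm]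
  push_cast
  rfl

/-- **Integrality of Néron multipliers, lattice form (transcendental proof).** For period pairs
`L₀`, `L` with integral invariants `12 g₂ = m₀, m`, `g₂³ − 27 g₃² = d₀, d`, no prime dividing both
`m` and `d`, and `q ∈ ℚˣ` with `q Λ₀ ⊆ Λ`: `q ∈ ℤ`. At a prime `p` of the denominator of `q` take a
valuation ring `A ⊆ ℂ` above `p` and apply the tree's dichotomy (Lang Ch. 12 §2 Thm. 2–4) to
`M = q Λ₀ ⊆ Λ` (`Δ(M) = q⁻¹² d₀`, `g₂(M) = q⁻⁴ m₀/12`): `j(L) = m³/d ∈ A` gives `d q¹²/d₀ ∈ A`,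
`ord_p d ≥ 12`, `ord_p m ≥ 4`; `j(L) ∉ A` gives `ord_p d > 3 ord_p m`, `m₀ ≠ 0` and
`m³ q¹²/m₀³ ∈ A`, `ord_p m ≥ 4`; either way `p ∣ gcd(m, d)`. (The finite half of Faltings' Lemma 5.)
[cite: Lang1987, Ch. 12 §2 Thm. 2–4] [cite: Faltings1986FinitenessTranslation, §3 Lemma 5 (proof)] -/
theorem exists_intCast_eq_of_mulLeft_lattice_le {L₀ L : PeriodPair} {m₀ d₀ m d : ℤ}
    (hm₀ : 12 * L₀.g₂ = m₀) (hd₀ : L₀.g₂ ^ 3 - 27 * L₀.g₃ ^ 2 = d₀)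
    (hm : 12 * L.g₂ = m) (hd : L.g₂ ^ 3 - 27 * L.g₃ ^ 2 = d)
    (hcop : ∀ p : ℕ, p.Prime → ¬ ((p : ℤ) ∣ m ∧ (p : ℤ) ∣ d))
    {q : ℚ} (hq : (q : ℂ) ≠ 0) (hle : (L₀.mulLeft (q : ℂ) hq).lattice ≤ L.lattice) :
    ∃ k : ℤ, (k : ℚ) = q := by
  classical
  by_cases hden : q.den = 1
  · exact ⟨q.num, Rat.coe_int_num_of_den_eq_one hden⟩
  exfalso
  -- a prime `p` in the denominator of `q`, a valuation ring `A ⊆ ℂ` above `p`; `ord_p q ≤ -1`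
  set p : ℕ := q.den.minFac with hp_def
  have hp : p.Prime := Nat.minFac_prime hden
  haveI : Fact p.Prime := ⟨hp⟩
  have hq0 : q ≠ 0 := by exact_mod_cast hq
  have hd₀0 : d₀ ≠ 0 := by have h := L₀.discr_ne_zero; rw [hd₀] at h; exact_mod_cast h
  have hd0 : d ≠ 0 := by have h := L.discr_ne_zero; rw [hd] at h; exact_mod_cast h
  obtain ⟨A, hA⟩ := exists_valuationSubring_ratCast_mem_iff p
  have hvq : padicValRat p q ≤ -1 := by
    have hpden : p ∣ q.den := Nat.minFac_dvd _
    have hnum : ¬ (p : ℤ) ∣ q.num := fun h ↦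
      Nat.not_coprime_of_dvd_of_dvd hp.one_lt (Int.natCast_dvd.mp h) hpden q.reduced
    rw [padicValRat_def, padicValInt.eq_zero_of_not_dvd hnum]
    have h1 : 1 ≤ padicValNat p q.den := one_le_padicValNat_of_dvd q.den_pos.ne' hpden
    omega
  obtain ⟨hvd₀, hvm₀, hvd, hvm⟩ := And.intro (padicValRat_intCast_nonneg p d₀) (And.intro
    (padicValRat_intCast_nonneg p m₀) (And.intro (padicValRat_intCast_nonneg p d)
    (padicValRat_intCast_nonneg p m)))
  have hj := j_eq_ratCast_of_intCast hm hd
  -- the dichotomy for `q Λ₀ ⊆ Λ`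
  have key := PeriodPair.valuationSubring_dichotomy_of_le hle A
  by_cases hjA : L.j ∈ A
  · -- `Δ(L)/Δ(qΛ₀) = d q¹² / d₀ ∈ A`: `ord_p d ≥ 12`, and then `j(L) ∈ A` gives `ord_p m ≥ 4`
    obtain ⟨-, hΔ⟩ := key.1 hjA
    have hquot : (L.g₂ ^ 3 - 27 * L.g₃ ^ 2) /
        ((L₀.mulLeft (q : ℂ) hq).g₂ ^ 3 - 27 * (L₀.mulLeft (q : ℂ) hq).g₃ ^ 2) =
          (((d : ℚ) * q ^ 12 / d₀ : ℚ) : ℂ) := by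
      have hd₀C : (d₀ : ℂ) ≠ 0 := by exact_mod_cast hd₀0
      rw [PeriodPair.discr_mulLeft, hd, hd₀]
      push_cast
      field_simp
    rw [hquot, hA, padicValRat.div (mul_ne_zero (by exact_mod_cast hd0) (pow_ne_zero _ hq0))
      (by exact_mod_cast hd₀0), padicValRat.mul (by exact_mod_cast hd0) (pow_ne_zero _ hq0),
      padicValRat.pow] at hΔ
    have hvd12 : 12 ≤ padicValRat p (d : ℚ) := by push_cast at hΔ; nlinarith
    have hpm : (p : ℤ) ∣ m := by
      by_cases hm0 : m = 0
      · rw [hm0]; exact dvd_zero _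
      rw [hj, hA, padicValRat.div (pow_ne_zero _ (by exact_mod_cast hm0)) (by exact_mod_cast hd0),
        padicValRat.pow] at hjA
      push_cast at hjA
      exact intCast_dvd_of_one_le_padicValRat (by nlinarith)
    exact hcop p hp ⟨hpm, intCast_dvd_of_one_le_padicValRat (by linarith)⟩
  · -- `j(Λ₀) ∉ A` forces `m₀ ≠ 0`; `g₂(L)³/g₂(qΛ₀)³ = m³ q¹² / m₀³ ∈ A` gives `ord_p m ≥ 4`
    obtain ⟨hjM, hg⟩ := key.2 hjA
    have hm₀0 : m₀ ≠ 0 := fun h0 ↦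
      hjM (by rw [PeriodPair.j_mulLeft, j_eq_ratCast_of_intCast hm₀ hd₀, h0]; simp)
    have hm0 : m ≠ 0 := fun h0 ↦ hjA (by rw [hj, h0]; simp)
    have hquot : L.g₂ ^ 3 / (L₀.mulLeft (q : ℂ) hq).g₂ ^ 3 =
        (((m : ℚ) ^ 3 * q ^ 12 / (m₀ : ℚ) ^ 3 : ℚ) : ℂ) := by
      have hm₀C : (m₀ : ℂ) ≠ 0 := by exact_mod_cast hm₀0
      have hg₂L : L.g₂ = (m : ℂ) / 12 := by rw [← hm]; ring
      have hg₂L₀ : L₀.g₂ = (m₀ : ℂ) / 12 := by rw [← hm₀]; ring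
      rw [PeriodPair.g₂_mulLeft, hg₂L, hg₂L₀]
      push_cast
      field_simp
    rw [hquot, hA, padicValRat.div (mul_ne_zero (pow_ne_zero _ (by exact_mod_cast hm0))
      (pow_ne_zero _ hq0)) (pow_ne_zero _ (by exact_mod_cast hm₀0)),
      padicValRat.mul (pow_ne_zero _ (by exact_mod_cast hm0)) (pow_ne_zero _ hq0),
      padicValRat.pow, padicValRat.pow, padicValRat.pow] at hg
    push_cast at hg
    have hpm : (p : ℤ) ∣ m := intCast_dvd_of_one_le_padicValRat (by nlinarith)
    -- `j(L) = m³/d ∉ A`: `ord_p d > 3 ord_p m ≥ 0`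
    rw [hj, hA, padicValRat.div (pow_ne_zero _ (by exact_mod_cast hm0)) (by exact_mod_cast hd0),
      padicValRat.pow] at hjA
    push_cast at hjA
    exact hcop p hp ⟨hpm, intCast_dvd_of_one_le_padicValRat (by nlinarith)⟩

/-- **Rational multipliers from a global minimal model into a SEMISTABLE global minimal model are
integers**: for globally minimal `W₀, W / ℚ`, `W` semistable elliptic, Néron-type period pairs
`L₀, L` and `q ∈ ℚ` with `q Λ₀ ⊆ Λ_W`, `q ∈ ℤ` — `exists_intCast_eq_of_mulLeft_lattice_le` with
`12 g₂ = c₄(W_ℤ)`, `g₂³ − 27g₃² = Δ(W_ℤ)` (`IsNeronLatticeOf.twelve_mul_g₂_eq_intCast`,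
`discr_eq_intCast`) and `gcd(c₄(W_ℤ), Δ(W_ℤ)) = 1` (`not_dvd_c₄_and_dvd_Δ_of_isSemistable`,
AEC VII.5.1). For a `ℚ`-isogeny `ψ : W₀ → W` (`ψ^*ω_W = q ω_{W₀}`) this is the integrality of `ψ^*`
on Néron differentials (Néron mapping property, ATAEC IV.5.1), here from the inclusion alone.
[cite: SilvermanAEC2009, VII.5 Prop. 5.1] [cite: Lang1987, Ch. 12 §2 Thm. 2–4] -/
theorem exists_intCast_eq_of_forall_mul_mem_lattice_of_isSemistable
    {W₀ W : WeierstrassCurve ℚ} [W₀.IsGloballyMinimal] [W.IsElliptic] [W.IsGloballyMinimal]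
    (hW : W.IsSemistable ℤ) {L₀ L : PeriodPair} (hL₀ : IsNeronLatticeOf (W₀.baseChange ℂ) L₀)
    (hL : IsNeronLatticeOf (W.baseChange ℂ) L) (q : ℚ)
    (hq : ∀ z ∈ L₀.lattice, (q : ℂ) * z ∈ L.lattice) : ∃ k : ℤ, (k : ℚ) = q := by
  by_cases hq0 : q = 0
  · exact ⟨0, by rw [hq0, Int.cast_zero]⟩
  have hqC : (q : ℂ) ≠ 0 := by exact_mod_cast hq0
  have hle : (L₀.mulLeft (q : ℂ) hqC).lattice ≤ L.lattice :=
    PeriodPair.mulLeft_lattice_le_of_forall_mul_mem hqC hq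
  -- the invariants of the two Néron lattices are those of the integral minimal models
  have h1 : ((1 : ℤ) : ℂ) ≠ 0 := by norm_num
  have hΛ : ∀ L' : PeriodPair, L'.lattice = (L'.mulLeft ((1 : ℤ) : ℂ) h1).lattice := fun L' ↦ by
    ext x
    rw [PeriodPair.mem_mulLeft_lattice]
    simp
  have hm₀ := (hL₀.twelve_mul_g₂_eq_intCast h1 (hΛ L₀)).1
  have hd₀ := hL₀.discr_eq_intCast h1 (hΛ L₀)
  have hm := (hL.twelve_mul_g₂_eq_intCast h1 (hΛ L)).1
  have hd := hL.discr_eq_intCast h1 (hΛ L)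
  simp only [one_pow, one_mul] at hm₀ hd₀ hm hd
  exact exists_intCast_eq_of_mulLeft_lattice_le hm₀ hd₀ hm hd
    (fun p hp ↦ W.not_dvd_c₄_and_dvd_Δ_of_isSemistable hW hp) hqC hle

/-- **`q Λ_f ⊆ Λ_{E'}` with `E'` semistable globally minimal forces `q ∈ ℤ`, granted a global
minimal `W₀` with Néron lattice inside `c₀ Λ_f`, `c₀ ∈ ℤ ∖ {0}`** (for the minimal model of
`A_{1,N}`: `Λ_{W₀} = c_f Λ_f`, Edixhoven Prop. 2): `(q/c₀)(c₀ w) = q w ∈ Λ_{E'}`, so `q/c₀ ∈ ℤ`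
(`exists_intCast_eq_of_forall_mul_mem_lattice_of_isSemistable`). [cite: EdixhovenManin1991, Prop. 2] -/
theorem exists_intCast_eq_multiplier_of_latticeOptimal
    {N : ℕ} [NeZero N] {W' : WeierstrassCurve ℚ} [W'.IsElliptic] [W'.IsGloballyMinimal]
    (hW' : W'.IsSemistable ℤ) (D' : ModularParametrizationData W' N)
    {W₀ : WeierstrassCurve ℚ} [W₀.IsGloballyMinimal] {L₀ : PeriodPair}
    (hL₀ : IsNeronLatticeOf (W₀.baseChange ℂ) L₀) {c₀ : ℤ} (hc₀ : c₀ ≠ 0)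
    (hopt : ∀ z ∈ L₀.lattice, ∃ w ∈ periodLattice D'.f, z = c₀ * w) (q : ℚ)
    (hq : ∀ z ∈ periodLattice D'.f, (q : ℂ) * z ∈ D'.L.lattice) : ∃ k : ℤ, (k : ℚ) = q := by
  have hc₀C : (c₀ : ℂ) ≠ 0 := Int.cast_ne_zero.mpr hc₀
  have hle : ∀ z ∈ L₀.lattice, ((q / c₀ : ℚ) : ℂ) * z ∈ D'.L.lattice := fun z hz ↦ by
    obtain ⟨w, hw, rfl⟩ := hopt z hz
    have h : ((q / c₀ : ℚ) : ℂ) * ((c₀ : ℂ) * w) = (q : ℂ) * w := by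
      push_cast
      field_simp
    rw [h]
    exact hq w hw
  obtain ⟨k, hk⟩ :=
    exists_intCast_eq_of_forall_mul_mem_lattice_of_isSemistable hW' hL₀ D'.isNeronLattice (q / c₀) hle
  refine ⟨k * c₀, ?_⟩
  have hc₀Q : (c₀ : ℚ) ≠ 0 := Int.cast_ne_zero.mpr hc₀
  push_cast
  rw [hk]
  field_simp

/-- **The SEMISTABLE slice of `hInt` from Edixhoven's Prop. 2 for the optimal curve.** Assume
(`hEd`, verbatim the hypothesis of the tree's `exists_optimal_modularParametrizationData_of_edixhoven`):
*a globally minimal elliptic `W'/ℚ` with newform `f` and a Néron-type pair spanning EXACTLY `q Λ_f`,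
`q ∈ ℚ`, has `q ∈ ℤ`* (the Manin constant of `A_{1,N}` is an integer: Edixhoven 1991 Prop. 2;
Agashe–Ribet–Stein 2006 Thm. 2.2; Pasten 2024 §3 p. 13). Then for every SEMISTABLE globally minimal
elliptic `W'` with a datum `D'` and `q ∈ ℚ` with `q Λ_f ⊆ Λ_{E'}`: `q ∈ ℤ` (the semistable case of
the `hInt` of `PastenShimura2024_minimalDegree_le_163_mul_of_mazurKenku`): the global minimal model
`C • E_f` of `E_f` (`exists_latticeEq_model`, `hasGlobalMinimalModel_rat_holds`) has Néron lattice
`u(C) Λ_f` (`IsNeronLatticeOf.lattice_eq_mulLeft_of_smul`), `u(C) ∈ ℤ` by `hEd`, and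
`exists_intCast_eq_multiplier_of_latticeOptimal`. [cite: EdixhovenManin1991, Prop. 2]
[cite: AgasheRibetStein2006, Thm. 2.2] [cite: SilvermanAEC2009, VIII.8.3] -/
theorem exists_intCast_eq_multiplier_of_isSemistable_of_edixhoven
    (hEd : ∀ {N : ℕ} [NeZero N] {W' : WeierstrassCurve ℚ} [W'.IsElliptic] [W'.IsGloballyMinimal]
      {f : CuspForm (Gamma0 N) 2} {L' : PeriodPair}, IsNewformOf W' f →
      IsNeronLatticeOf (W'.baseChange ℂ) L' → ∀ q : ℚ,
      (∀ z ∈ periodLattice f, (q : ℂ) * z ∈ L'.lattice) →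
      (∀ z ∈ L'.lattice, ∃ w ∈ periodLattice f, z = q * w) → ∃ k : ℤ, (k : ℚ) = q)
    {N : ℕ} [NeZero N] {W' : WeierstrassCurve ℚ} [W'.IsElliptic] [W'.IsGloballyMinimal]
    (hW' : W'.IsSemistable ℤ) (D' : ModularParametrizationData W' N) (q : ℚ)
    (hq : ∀ z ∈ periodLattice D'.f, (q : ℂ) * z ∈ D'.L.lattice) : ∃ k : ℤ, (k : ℚ) = q := by
  -- the global minimal model `C • E_f` of `E_f`, with Néron lattice `u Λ_f`, `u = u(C) ∈ ℚˣ`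
  -- (adapted from `ModularParametrizationData.exists_isGloballyMinimal_latticeEq_rat`,
  -- `Literature/NumberTheory/Automorphic/ShimuraCurveRibetTakahashiOptimalProofs.lean`)
  obtain ⟨W₁, hW₁, hf₁, L₁, hL₁, hΛ⟩ := D'.exists_latticeEq_model
  haveI := hW₁
  have hmem : ∀ z, z ∈ L₁.lattice ↔ z ∈ periodLattice D'.f := fun z ↦ by
    rw [← SetLike.mem_coe, hΛ, SetLike.mem_coe]
  obtain ⟨C, hC⟩ := WeierstrassCurve.hasGlobalMinimalModel_rat_holds W₁
  haveI := hC
  haveI : ((C • W₁).baseChange ℂ).IsElliptic := by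
    rw [WeierstrassCurve.baseChange]; infer_instance
  obtain ⟨L₀, hL₀⟩ := exists_isNeronLatticeOf_holds ((C • W₁).baseChange ℂ)
  have huC : ((C.u : ℚ) : ℂ) ≠ 0 := by exact_mod_cast C.u.ne_zero
  have hΛ₀ := IsNeronLatticeOf.lattice_eq_mulLeft_of_smul C hL₁ hL₀
  have hf₀ : IsNewformOf (C • W₁) D'.f :=
    hf₁.of_isIsogenous (WeierstrassCurve.isIsogenous_of_smul W₁ C)
  have hu' : ∀ z ∈ L₀.lattice, ∃ w ∈ periodLattice D'.f, z = (C.u : ℚ) * w := fun z hz ↦ by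
    rw [hΛ₀, PeriodPair.mem_mulLeft_lattice, hmem] at hz
    exact ⟨((C.u : ℚ) : ℂ)⁻¹ * z, hz, by rw [← mul_assoc, mul_inv_cancel₀ huC, one_mul]⟩
  -- `u = c₀ ∈ ℤ` by `hEd`
  obtain ⟨c₀, hc₀⟩ := hEd hf₀ hL₀ (C.u : ℚ)
    (fun z hz ↦ by rw [hΛ₀, PeriodPair.mul_mem_mulLeft_lattice, hmem]; exact hz) hu'
  have hc₀0 : c₀ ≠ 0 := by
    rintro rfl
    exact C.u.ne_zero (by rw [← hc₀, Int.cast_zero])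
  have hc₀C : (c₀ : ℂ) = ((C.u : ℚ) : ℂ) := by rw [← hc₀, Rat.cast_intCast]
  exact exists_intCast_eq_multiplier_of_latticeOptimal hW' D' hL₀ hc₀0
    (fun z hz ↦ by rw [hc₀C]; exact hu' z hz) q hq

open _root_.WeierstrassCurve in
/-- **`hMK` at one datum, from Mazur–Kenku and the integrality of that datum's multipliers**: for
a globally minimal elliptic `W'` with datum `D'` such that every rational `q` with `q Λ_f ⊆ Λ_{E'}`
is an integer (`hInt'`), some `k ∈ ℤ ∖ {0}` has `k Λ_f ⊆ Λ_{E'}` and `#ker(z ↦ kz) ≤ 163` (Pasten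
2024 §3 p. 13: optimal parametrisation, then a minimal `ℚ`-isogeny `A_{1,N} → E'` of degree `≤ 163`,
Mazur 1978 Thm. 1, Kenku 1982). The tree's `PastenShimura2024_minimalDegree_le_163_mul_of_mazurKenku`
verbatim, localised at `D'`: Mazur–Kenku between the short models of `E_f` (`exists_latticeEq_model`)
and `W'`, the rational multiplier (`degree_eq_natCard_ker_mulQuotientMap_of_baseChange_eq_curve`),
`q ∈ ℤ` by `hInt'`. [cite: PastenShimura2024, §3 p. 13] [cite: Mazur1978, Thm. 1] [cite: Kenku1982]
[cite: SilvermanAEC2009, IX.6 Example 6.4] -/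
theorem exists_int_natCard_ker_le_163_of_int_multiplier (hMK : mazurKenku_exists_cyclic_isogeny)
    {N : ℕ} [NeZero N] {W' : WeierstrassCurve ℚ} [W'.IsElliptic] [W'.IsGloballyMinimal]
    (D' : ModularParametrizationData W' N)
    (hInt' : ∀ q : ℚ, (∀ z ∈ periodLattice D'.f, (q : ℂ) * z ∈ D'.L.lattice) →
      ∃ k : ℤ, (k : ℚ) = q) :
    ∃ (k : ℤ) (hk : ∀ z ∈ periodLattice D'.f, (k : ℂ) * z ∈ D'.L.lattice), k ≠ 0 ∧
      Nat.card (mulQuotientMap (periodLattice D'.f) D'.L.lattice.toAddSubgroup (k : ℂ) hk).ker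
        ≤ 163 := by
  -- adapted from `PastenShimura2024_minimalDegree_le_163_mul_of_mazurKenku`
  obtain ⟨W₀, hW₀, -, L₀, hL₀, hΛ⟩ := D'.exists_latticeEq_model
  haveI := hW₀
  have hmem : ∀ z, z ∈ L₀.lattice ↔ z ∈ periodLattice D'.f := fun z ↦ by
    rw [← SetLike.mem_coe, hΛ, SetLike.mem_coe]
  -- `W₀ = E_f ~ W'` over `ℚ`, along `z ↦ c' z`
  have hc : (D'.c : ℚ) ≠ 0 := by exact_mod_cast D'.maninConstant_ne_zero_holds
  have hle : ∀ z ∈ L₀.lattice, ((D'.c : ℚ) : ℂ) * z ∈ D'.L.lattice := fun z hz ↦ by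
    rw [Rat.cast_intCast]
    exact D'.smul_periodLattice_le z ((hmem z).mp hz)
  have hiso : IsIsogenous W₀ W' :=
    isIsogenous_of_forall_mul_mem_lattice hL₀.1 hL₀.2 D'.isNeronLattice.1 D'.isNeronLattice.2 hc hle
  -- the short models are `E_{Λ_f}`, `E_{Λ_{E'}}` after base change, and are `ℚ`-isogenous
  set C₀ : VariableChange ℚ := ⟨1, -W₀.b₂ / 12, -W₀.a₁ / 2, W₀.a₁ * W₀.b₂ / 24 - W₀.a₃ / 2⟩
    with hC₀
  set C' : VariableChange ℚ := ⟨1, -W'.b₂ / 12, -W'.a₁ / 2, W'.a₁ * W'.b₂ / 24 - W'.a₃ / 2⟩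
    with hC'
  have hE₀ : (C₀ • W₀).baseChange ℂ = L₀.curve := shortModel_baseChange_eq_curve W₀ hL₀
  have hE' : (C' • W').baseChange ℂ = D'.L.curve := shortModel_baseChange_eq_curve W' D'.isNeronLattice
  have h : IsIsogenous (C₀ • W₀) (C' • W') :=
    (isIsogenous_of_smul W₀ C₀).trans' (hiso.trans' (isIsogenous_smul W' C'))
  -- Mazur–Kenku: a cyclic `ℚ`-isogeny `ψ` of degree `≤ 163`; its rational multiplier `q`
  obtain ⟨ψ, -, hdeg⟩ := hMK (C₀ • W₀) (C' • W') h
  have h163 : ψ.degree ≤ 163 := le_of_mem_kenkuDegrees hdeg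
  obtain ⟨q, hq0, hq, hdegq⟩ :=
    degree_eq_natCard_ker_mulQuotientMap_of_baseChange_eq_curve ψ hE₀ hE'
  have hq' : ∀ z ∈ periodLattice D'.f, (q : ℂ) * z ∈ D'.L.lattice := fun z hz ↦
    hq z ((hmem z).mpr hz)
  -- `q = k ∈ ℤ`
  obtain ⟨k, rfl⟩ := hInt' q hq'
  have hk : ∀ z ∈ periodLattice D'.f, (k : ℂ) * z ∈ D'.L.lattice := fun z hz ↦ by
    have := hq' z hz
    rwa [Rat.cast_intCast] at this
  refine ⟨k, hk, by exact_mod_cast hq0, ?_⟩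
  have hΛ' : L₀.lattice.toAddSubgroup = periodLattice D'.f :=
    SetLike.coe_injective (by rw [Submodule.coe_toAddSubgroup, hΛ])
  have hcast : ((k : ℚ) : ℂ) = (k : ℂ) := Rat.cast_intCast k
  calc Nat.card (mulQuotientMap (periodLattice D'.f) D'.L.lattice.toAddSubgroup (k : ℂ) hk).ker
      = Nat.card (mulQuotientMap L₀.lattice.toAddSubgroup D'.L.lattice.toAddSubgroup
          ((k : ℚ) : ℂ) hq).ker := by
        simp only [hcast]
        exact (natCard_ker_mulQuotientMap_congr hΛ' rfl (fun z hz ↦ hk z (hΛ' ▸ hz)) hk).symm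
    _ = ψ.degree := hdegq.symm
    _ ≤ 163 := h163

/-- **RESHAPED STUB `stub_mazurKenku`** (crux A stmt-ABC-2045, line `newpart_congruence_friability`):
the Mazur–Kenku comparison in PRODUCT form for SEMISTABLE curves — verbatim the conclusion of
`PastenShimura2024_exists_datum_modularDegree_eq_mul_of`, the ONLY form in which the frame's glue
`degreePrimesPolyBounded_of_newPartPrimesOfDatum` consumes the stub (its single call
`PastenShimura2024_exists_datum_modularDegree_eq_mul_of hMK N W₀ W D₀ D₁ hf₀.symm hmin` at the
semistable globally minimal `W` at hand, `hW : W.IsSemistable ℤ`), under the extra hypothesis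
`W.IsSemistable ℤ` — from (1) the named fact `mazurKenku_exists_cyclic_isogeny` (Mazur 1978 Thm. 1;
Kenku 1982; AEC IX.6 Ex. 6.4) and (2) `hEd`, Edixhoven 1991 Prop. 2 for the OPTIMAL curve, stated
structurally (verbatim the `hEd` of the tree's `exists_optimal_modularParametrizationData_of_edixhoven`,
hence supplied by the named fact `exists_optimal_modularParametrizationData`): if `D₀` is
class-minimal at level `N` and the semistable globally minimal `W` carries a datum `D₁` with the
same newform, then `W` carries such a datum of degree `k · deg φ_{D₀}`, `1 ≤ k ≤ 163` (Pasten 2024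
§3 p. 13). Relative to `PastenShimura2024_minimalDegree_le_163_mul_of_mazurKenku` the
Stevens-strength `hInt` is replaced by Edixhoven's Prop. 2 for `A_{1,N}` alone, the rest PROVED.
[cite: PastenShimura2024, §3 p. 13] [cite: Mazur1978, Thm. 1] [cite: Kenku1982]
[cite: EdixhovenManin1991, Prop. 2] -/
theorem stub_mazurKenkuSemistable_of_mazurIsogeny_of_edixhoven :
    mazurKenku_exists_cyclic_isogeny →
    (∀ {N : ℕ} [NeZero N] {W' : WeierstrassCurve ℚ} [W'.IsElliptic] [W'.IsGloballyMinimal]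
      {f : CuspForm (Gamma0 N) 2} {L' : PeriodPair}, IsNewformOf W' f →
      IsNeronLatticeOf (W'.baseChange ℂ) L' → ∀ q : ℚ,
      (∀ z ∈ periodLattice f, (q : ℂ) * z ∈ L'.lattice) →
      (∀ z ∈ L'.lattice, ∃ w ∈ periodLattice f, z = q * w) → ∃ k : ℤ, (k : ℚ) = q) →
    ∀ (N : ℕ) [NeZero N] (W₀ W : WeierstrassCurve ℚ) [W₀.IsElliptic] [W.IsElliptic]
      [W.IsGloballyMinimal], W.IsSemistable ℤ →
      ∀ (D₀ : ModularParametrizationData W₀ N) (D₁ : ModularParametrizationData W N),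
      D₁.f = D₀.f →
      (∀ (W' : WeierstrassCurve ℚ) [W'.IsElliptic] (D' : ModularParametrizationData W' N),
          D'.f = D₀.f → D₀.modularDegree ≤ D'.modularDegree) →
      ∃ (D : ModularParametrizationData W N) (k : ℕ),
        D.f = D₀.f ∧ 0 < k ∧ k ≤ 163 ∧ D.modularDegree = k * D₀.modularDegree := by
  intro hMK hEd N _ W₀ W _ _ _ hW D₀ D₁ hf hmin
  obtain ⟨k, hk, hk0, hk163⟩ := exists_int_natCard_ker_le_163_of_int_multiplier hMK D₁
    (exists_intCast_eq_multiplier_of_isSemistable_of_edixhoven hEd hW D₁)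
  exact D₀.exists_datum_modularDegree_eq_mul_of_natCard_ker_le D₁ hf hmin hk hk0 hk163

end Summit.ABC.ABC.Theorems.DegreePrimesPolyBounded

end
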